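import Summits.HodgeConjecture.HodgeConjecture.Theses.AdelicCoherence
import Literature.AlgebraicGeometry.Motives.MotivatedCyclesLefschetzProofs

/-!
# Line `pieces-split` — `AdelicCoherence.CoherentClassesAlgebraic` (stmt-HodgeConjecture-13696) DERIVED from two typed pieces

Registered skeleton of the crux-strategist BC2-redirect decomposition (unit `cstrat-stmt-HodgeConjecture-13696-r1`).
Two stubs, each the VERBATIM statement of a piece (route items `CoherentClassesMotivated`, `MotivatedClassesAlgebraic`
once `route edit --split` lands them):

* `stub_coherentClassesMotivated` (CM, 'absolutely Hodge-and-Tate ⇒ MOTIVATED'): same hypotheses as the crux — a k-plane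
  `W ≤ H²ᵖ_dR(X/k)` whose ρ-complexification lies in the Hodge plane of `X_ρ` and all of whose elements are potentially Tate
  at every good place for every crystalline Frobenius datum — and the conclusion that every Hodge class `β` with `β ⊗ 1`
  in the ℂ-span of `ι(W)` lies in the ℚ-span of André's motivated classes `pr_X* (α ∪ ⋆γ)` of `P.B.W` on `X_ρ`
  (André 1996 Déf. 1, INLINED over `IsHyperplaneClass` / `IsLefschetzStar` / `ratAlgebraicClasses` / `cupPairing`
  so that the route file needs no new import; the span is `WeilCohomology.motivatedClasses` by `rfl`,
  `inlinedSpan_eq_motivatedClasses`);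
* `stub_motivatedClassesAlgebraic` (MA, 'motivated ⇒ algebraic on number-field varieties'): for `X` smooth projective
  over a number field and `ρ : k →+* ℂ`, that ℚ-span is contained in `P.B.W.algebraicClasses X_ρ p` — the exact
  consequence of Grothendieck's standard conjecture `B` for `P.B.W` that the crux consumes (`B ⇒ MA` is the tree theorem
  `WeilCohomology.motivatedClasses_le_algebraicClasses`, see `motivatedClassesAlgebraic_of_lefschetzB` below);

and the kernel-checked composition `CoherentClassesAlgebraic_of` concluding the crux BY NAME.
Layout (A12 skeleton-audit shape): §1 the two stub STATEMENTS as reducible `Prop` abbreviations `Statement.stub_<name>`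
(obligation nodes BY NAME = the admissible hypotheses of `CoherentClassesAlgebraic_of`); §2 the two sorried stubs with their
signatures WRITTEN OUT (= the registered text); §3 the composition, an `example` re-checking the literal written-out form,
and `coherentClassesAlgebraic : <crux>` from the stubs; §4 sanity theorems (`rfl` to the tree's `motivatedClasses`,
`B ⇒ MA`, `C ⇒ CM`). Card: `Lines/pieces-split.md`. Birth skeletons: `Lines/p1_birth.lean` (CM), `Lines/p2_birth.lean` (MA).
-/

set_option linter.dupNamespace false
set_option linter.unusedVariables false

namespace Summit.HodgeConjecture.HodgeConjecture.Cruxes.CoherentClassesAlgebraic.PiecesSplit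

open Literature.AlgebraicGeometry.Motives CategoryTheory MonoidalCategory CartesianMonoidalCategory
open Summit.HodgeConjecture.HodgeConjecture.Theses.AdelicCoherence

/-! ### §1 The stub statements as obligation nodes (by name) -/

/-- Statement of `stub_coherentClassesMotivated` = piece CM `CoherentClassesMotivated`, verbatim. -/
abbrev Statement.stub_coherentClassesMotivated : Prop :=
  ∀ ⦃k : Type⦄ [Field k] [NumberField k] (ρ : k →+* ℂ) (P : PeriodRealization k), HodgeRiemannIStatement P.B → HodgeRiemannIIStatement P.B → P.B.W.HasHardLefschetz → ∀ ⦃n : ℕ⦄ ⦃X : SchemeOver k⦄, IsSmoothProjective n X → ∀ (hXρ : IsSmoothProjective n ((baseChangeHom ρ).obj X)) (p : ℕ) (W : Submodule k (P.dR.obj X (2 * p))), (∀ w ∈ W, alongHomTensorEquiv ρ ((P.B.comap ρ).obj X (2 * p)) (P.iso ρ X (2 * p) ((1 : AlongHom ℂ ρ) ⊗ₜ[k] w)) ∈ ((P.B.hodge hXρ (2 * p)).hodgeClasses p).baseChange ℂ) → (∀ (v : IsDedekindDomain.HeightOneSpectrum (NumberField.RingOfIntegers k)), HasGoodReductionAt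 X n v → ∀ (Φ : CrystallineFrobeniusDatum P.dR v (v.adicCompletion k)), ∀ w ∈ W, ∃ m : ℕ, 0 < m ∧ ((Φ.phi X (2 * p)) ^ m) ((1 : v.adicCompletion k) ⊗ₜ[k] w) = ((v.residueCard : v.adicCompletion k) ^ (p * m)) • ((1 : v.adicCompletion k) ⊗ₜ[k] w)) → ∀ β ∈ (P.B.hodge hXρ (2 * p)).hodgeClasses p, (1 : ℂ) ⊗ₜ[ℚ] β ∈ Submodule.span ℂ ((fun w => alongHomTensorEquiv ρ ((P.B.comap ρ).obj X (2 * p)) (P.iso ρ X (2 * p) ((1 : AlongHom ℂ ρ) ⊗ₜ[k] w))) '' (W : Set (P.dR.obj X (2 * p)))) → β ∈ Submodule.span ℚ {x : P.B.W.obj ((baseChangeHom ρ).obj X) (2 * p) | ∃ (m : ℕ) (Y : SchemeOver ℂ) (_ : IsSmoothProjective m Y) (η : P.B.W.obj (((baseChangeHom ρ).obj X) ⊗ Y) 2) (_ : P.B.W.IsHyperplaneClass (((baseChangeHom ρ).obj X) ⊗ Y) η) (S : P.B.W.GradedOp (((baseChangeHom ρ).obj X) ⊗ Y) (((baseChangeHom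 ρ).obj X) ⊗ Y)) (_ : P.B.W.IsLefschetzStar (n + m) η S) (a b b' : ℕ) (_ : b + b' = n + m) (hab : a + b' = p + m) (α : P.B.W.obj (((baseChangeHom ρ).obj X) ⊗ Y) (2 * a)) (γ : P.B.W.obj (((baseChangeHom ρ).obj X) ⊗ Y) (2 * b)), α ∈ P.B.W.ratAlgebraicClasses (((baseChangeHom ρ).obj X) ⊗ Y) a ∧ γ ∈ P.B.W.ratAlgebraicClasses (((baseChangeHom ρ).obj X) ⊗ Y) b ∧ ∀ (q : ℕ) (hq : p + q = n) (y : P.B.W.obj ((baseChangeHom ρ).obj X) (2 * q)), P.B.W.cupPairing ((baseChangeHom ρ).obj X) n (2 * p) (2 * q) (by omega) x y = P.B.W.trace (((baseChangeHom ρ).obj X) ⊗ Y) (n + m) (P.B.W.cup (show 2 * (p + m) + 2 * q = 2 * (n + m) by omega) (P.B.W.cup (show 2 * a + 2 * b' = 2 * (p + m) by omega) α (S (2 * b) (2 * b') γ)) (P.B.W.pullback (fst ((baseChangeHom ρ).obj X) Y) (2 * q) y))}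

/-- Statement of `stub_motivatedClassesAlgebraic` = piece MA `MotivatedClassesAlgebraic`, verbatim. -/
abbrev Statement.stub_motivatedClassesAlgebraic : Prop :=
  ∀ ⦃k : Type⦄ [Field k] [NumberField k] (ρ : k →+* ℂ) (P : PeriodRealization k), HodgeRiemannIStatement P.B → HodgeRiemannIIStatement P.B → P.B.W.HasHardLefschetz → ∀ ⦃n : ℕ⦄ ⦃X : SchemeOver k⦄, IsSmoothProjective n X → ∀ (hXρ : IsSmoothProjective n ((baseChangeHom ρ).obj X)) (p : ℕ), Submodule.span ℚ {x : P.B.W.obj ((baseChangeHom ρ).obj X) (2 * p) | ∃ (m : ℕ) (Y : SchemeOver ℂ) (_ : IsSmoothProjective m Y) (η : P.B.W.obj (((baseChangeHom ρ).obj X) ⊗ Y) 2) (_ : P.B.W.IsHyperplaneClass (((baseChangeHom ρ).obj X) ⊗ Y) η) (S : P.B.W.GradedOp (((baseChangeHom ρ).obj X) ⊗ Y) (((baseChangeHom ρ).obj X) ⊗ Y)) (_ : P.B.W.IsLefschetzStar (n + m) η S) (a b b' : ℕ) (_ : b + b' = n + m) (hab : a + b' = p + m) (α : P.B.W.obj (((baseChangeHom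 ρ).obj X) ⊗ Y) (2 * a)) (γ : P.B.W.obj (((baseChangeHom ρ).obj X) ⊗ Y) (2 * b)), α ∈ P.B.W.ratAlgebraicClasses (((baseChangeHom ρ).obj X) ⊗ Y) a ∧ γ ∈ P.B.W.ratAlgebraicClasses (((baseChangeHom ρ).obj X) ⊗ Y) b ∧ ∀ (q : ℕ) (hq : p + q = n) (y : P.B.W.obj ((baseChangeHom ρ).obj X) (2 * q)), P.B.W.cupPairing ((baseChangeHom ρ).obj X) n (2 * p) (2 * q) (by omega) x y = P.B.W.trace (((baseChangeHom ρ).obj X) ⊗ Y) (n + m) (P.B.W.cup (show 2 * (p + m) + 2 * q = 2 * (n + m) by omega) (P.B.W.cup (show 2 * a + 2 * b' = 2 * (p + m) by omega) α (S (2 * b) (2 * b') γ)) (P.B.W.pullback (fst ((baseChangeHom ρ).obj X) Y) (2 * q) y))} ≤ P.B.W.algebraicClasses ((baseChangeHom ρ).obj X) p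

/-! ### §2 The two registered stubs (signatures written out) -/

/-- **CM — coherent Hodge classes are motivated** (piece 1; Ogus 1982 Hope 4.11.3 + 'absolute Hodge ⇒ motivated',
André 1996 Thm 0.6.2 / Prop 2.5.1 / remark p. 9). [Ogus1982; Andre1996Motifs; Deligne1982HodgeCycles] -/
theorem stub_coherentClassesMotivated :
    ∀ ⦃k : Type⦄ [Field k] [NumberField k] (ρ : k →+* ℂ) (P : PeriodRealization k), HodgeRiemannIStatement P.B → HodgeRiemannIIStatement P.B → P.B.W.HasHardLefschetz → ∀ ⦃n : ℕ⦄ ⦃X : SchemeOver k⦄, IsSmoothProjective n X → ∀ (hXρ : IsSmoothProjective n ((baseChangeHom ρ).obj X)) (p : ℕ) (W : Submodule k (P.dR.obj X (2 * p))), (∀ w ∈ W, alongHomTensorEquiv ρ ((P.B.comap ρ).obj X (2 * p)) (P.iso ρ X (2 * p) ((1 : AlongHom ℂ ρ) ⊗ₜ[k] w)) ∈ ((P.B.hodge hXρ (2 * p)).hodgeClasses p).baseChange ℂ) → (∀ (v : IsDedekindDomain.HeightOneSpectrum (NumberField.RingOfIntegers k)), HasGoodReductionAt X n v → ∀ (Φ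 : CrystallineFrobeniusDatum P.dR v (v.adicCompletion k)), ∀ w ∈ W, ∃ m : ℕ, 0 < m ∧ ((Φ.phi X (2 * p)) ^ m) ((1 : v.adicCompletion k) ⊗ₜ[k] w) = ((v.residueCard : v.adicCompletion k) ^ (p * m)) • ((1 : v.adicCompletion k) ⊗ₜ[k] w)) → ∀ β ∈ (P.B.hodge hXρ (2 * p)).hodgeClasses p, (1 : ℂ) ⊗ₜ[ℚ] β ∈ Submodule.span ℂ ((fun w => alongHomTensorEquiv ρ ((P.B.comap ρ).obj X (2 * p)) (P.iso ρ X (2 * p) ((1 : AlongHom ℂ ρ) ⊗ₜ[k] w))) '' (W : Set (P.dR.obj X (2 * p)))) → β ∈ Submodule.span ℚ {x : P.B.W.obj ((baseChangeHom ρ).obj X) (2 * p) | ∃ (m : ℕ) (Y : SchemeOver ℂ) (_ : IsSmoothProjective m Y) (η : P.B.W.obj (((baseChangeHom ρ).obj X) ⊗ Y) 2) (_ : P.B.W.IsHyperplaneClass (((baseChangeHom ρ).obj X) ⊗ Y) η) (S : P.B.W.GradedOp (((baseChangeHom ρ).obj X) ⊗ Y) (((baseChangeHom ρ).obj X) ⊗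 Y)) (_ : P.B.W.IsLefschetzStar (n + m) η S) (a b b' : ℕ) (_ : b + b' = n + m) (hab : a + b' = p + m) (α : P.B.W.obj (((baseChangeHom ρ).obj X) ⊗ Y) (2 * a)) (γ : P.B.W.obj (((baseChangeHom ρ).obj X) ⊗ Y) (2 * b)), α ∈ P.B.W.ratAlgebraicClasses (((baseChangeHom ρ).obj X) ⊗ Y) a ∧ γ ∈ P.B.W.ratAlgebraicClasses (((baseChangeHom ρ).obj X) ⊗ Y) b ∧ ∀ (q : ℕ) (hq : p + q = n) (y : P.B.W.obj ((baseChangeHom ρ).obj X) (2 * q)), P.B.W.cupPairing ((baseChangeHom ρ).obj X) n (2 * p) (2 * q) (by omega) x y = P.B.W.trace (((baseChangeHom ρ).obj X) ⊗ Y) (n + m) (P.B.W.cup (show 2 * (p + m) + 2 * q = 2 * (n + m) by omega) (P.B.W.cup (show 2 * a + 2 * b' = 2 * (p + m) by omega) α (S (2 * b) (2 * b') γ)) (P.B.W.pullback (fst ((baseChangeHom ρ).obj X) Y) (2 * q) y))} := by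
  sorry

/-- **MA — motivated classes on number-field varieties are algebraic** (piece 2; the consumed consequence of the standard
conjecture of Lefschetz type `B(P.B.W)`, André 1996 §2.1 remark after Déf. 1 + Kleiman 1968 Prop. 2.3; auxiliary varieties
may be taken number-field-definable by André 1996 §2.5 Scolie). [Grothendieck1969StandardConjectures; Kleiman1968AlgebraicCycles; Andre1996Motifs] -/
theorem stub_motivatedClassesAlgebraic :
    ∀ ⦃k : Type⦄ [Field k] [NumberField k] (ρ : k →+* ℂ) (P : PeriodRealization k), HodgeRiemannIStatement P.B → HodgeRiemannIIStatement P.B → P.B.W.HasHardLefschetz → ∀ ⦃n : ℕ⦄ ⦃X : SchemeOver k⦄, IsSmoothProjective n X → ∀ (hXρ : IsSmoothProjective n ((baseChangeHom ρ).obj X)) (p : ℕ), Submodule.span ℚ {x : P.B.W.obj ((baseChangeHom ρ).obj X) (2 * p) | ∃ (m : ℕ) (Y : SchemeOver ℂ) (_ : IsSmoothProjective m Y) (η : P.B.W.obj (((baseChangeHom ρ).obj X) ⊗ Y) 2) (_ : P.B.W.IsHyperplaneClass (((baseChangeHom ρ).obj X) ⊗ Y) η) (S : P.B.W.GradedOp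 (((baseChangeHom ρ).obj X) ⊗ Y) (((baseChangeHom ρ).obj X) ⊗ Y)) (_ : P.B.W.IsLefschetzStar (n + m) η S) (a b b' : ℕ) (_ : b + b' = n + m) (hab : a + b' = p + m) (α : P.B.W.obj (((baseChangeHom ρ).obj X) ⊗ Y) (2 * a)) (γ : P.B.W.obj (((baseChangeHom ρ).obj X) ⊗ Y) (2 * b)), α ∈ P.B.W.ratAlgebraicClasses (((baseChangeHom ρ).obj X) ⊗ Y) a ∧ γ ∈ P.B.W.ratAlgebraicClasses (((baseChangeHom ρ).obj X) ⊗ Y) b ∧ ∀ (q : ℕ) (hq : p + q = n) (y : P.B.W.obj ((baseChangeHom ρ).obj X) (2 * q)), P.B.W.cupPairing ((baseChangeHom ρ).obj X) n (2 * p) (2 * q) (by omega) x y = P.B.W.trace (((baseChangeHom ρ).obj X) ⊗ Y) (n + m) (P.B.W.cup (show 2 * (p + m) + 2 * q = 2 * (n + m) by omega) (P.B.W.cup (show 2 * a + 2 * b' = 2 * (p + m) by omega) α (S (2 * b) (2 * b') γ)) (P.B.W.pullback (fst ((baseChangeHom ρ).obj X) Y) (2 * q) y))} ≤ P.B.W.algebraicClasses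 ((baseChangeHom ρ).obj X) p := by
  sorry

/-! ### §3 The composition -/

/-- **Composition (kernel-checked): CM → MA → the crux `CoherentClassesAlgebraic` by name.** -/
theorem CoherentClassesAlgebraic_of :
    Statement.stub_coherentClassesMotivated → Statement.stub_motivatedClassesAlgebraic →
    Summit.HodgeConjecture.HodgeConjecture.Theses.AdelicCoherence.CoherentClassesAlgebraic := by
  intro hCM hMA k _ _ ρ P hI hII hL n X hX hXρ p W hW hT β hβ hspan
  exact hMA ρ P hI hII hL hX hXρ p (hCM ρ P hI hII hL hX hXρ p W hW hT β hβ hspan)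

/-- The literal written-out form of the composition (same term). -/
example :
    (∀ ⦃k : Type⦄ [Field k] [NumberField k] (ρ : k →+* ℂ) (P : PeriodRealization k), HodgeRiemannIStatement P.B → HodgeRiemannIIStatement P.B → P.B.W.HasHardLefschetz → ∀ ⦃n : ℕ⦄ ⦃X : SchemeOver k⦄, IsSmoothProjective n X → ∀ (hXρ : IsSmoothProjective n ((baseChangeHom ρ).obj X)) (p : ℕ) (W : Submodule k (P.dR.obj X (2 * p))), (∀ w ∈ W, alongHomTensorEquiv ρ ((P.B.comap ρ).obj X (2 * p)) (P.iso ρ X (2 * p) ((1 : AlongHom ℂ ρ) ⊗ₜ[k] w)) ∈ ((P.B.hodge hXρ (2 * p)).hodgeClasses p).baseChange ℂ) → (∀ (v : IsDedekindDomain.HeightOneSpectrum (NumberField.RingOfIntegers k)), HasGoodReductionAt X n v → ∀ (Φ : CrystallineFrobeniusDatum P.dR v (v.adicCompletion k)), ∀ w ∈ W, ∃ m : ℕ, 0 < m ∧ ((Φ.phi X (2 * p)) ^ m) ((1 : v.adicCompletion k) ⊗ₜ[k] w) = ((v.residueCard : v.adicCompletion k) ^ (p * m)) • ((1 : v.adicCompletion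 k) ⊗ₜ[k] w)) → ∀ β ∈ (P.B.hodge hXρ (2 * p)).hodgeClasses p, (1 : ℂ) ⊗ₜ[ℚ] β ∈ Submodule.span ℂ ((fun w => alongHomTensorEquiv ρ ((P.B.comap ρ).obj X (2 * p)) (P.iso ρ X (2 * p) ((1 : AlongHom ℂ ρ) ⊗ₜ[k] w))) '' (W : Set (P.dR.obj X (2 * p)))) → β ∈ Submodule.span ℚ {x : P.B.W.obj ((baseChangeHom ρ).obj X) (2 * p) | ∃ (m : ℕ) (Y : SchemeOver ℂ) (_ : IsSmoothProjective m Y) (η : P.B.W.obj (((baseChangeHom ρ).obj X) ⊗ Y) 2) (_ : P.B.W.IsHyperplaneClass (((baseChangeHom ρ).obj X) ⊗ Y) η) (S : P.B.W.GradedOp (((baseChangeHom ρ).obj X) ⊗ Y) (((baseChangeHom ρ).obj X) ⊗ Y)) (_ : P.B.W.IsLefschetzStar (n + m) η S) (a b b' : ℕ) (_ : b + b' = n + m) (hab : a + b' = p + m) (α : P.B.W.obj (((baseChangeHom ρ).obj X) ⊗ Y) (2 * a)) (γ : P.B.W.obj (((baseChangeHom ρ).obj X) ⊗ Y) (2 *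 b)), α ∈ P.B.W.ratAlgebraicClasses (((baseChangeHom ρ).obj X) ⊗ Y) a ∧ γ ∈ P.B.W.ratAlgebraicClasses (((baseChangeHom ρ).obj X) ⊗ Y) b ∧ ∀ (q : ℕ) (hq : p + q = n) (y : P.B.W.obj ((baseChangeHom ρ).obj X) (2 * q)), P.B.W.cupPairing ((baseChangeHom ρ).obj X) n (2 * p) (2 * q) (by omega) x y = P.B.W.trace (((baseChangeHom ρ).obj X) ⊗ Y) (n + m) (P.B.W.cup (show 2 * (p + m) + 2 * q = 2 * (n + m) by omega) (P.B.W.cup (show 2 * a + 2 * b' = 2 * (p + m) by omega) α (S (2 * b) (2 * b') γ)) (P.B.W.pullback (fst ((baseChangeHom ρ).obj X) Y) (2 * q) y))}) →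
    (∀ ⦃k : Type⦄ [Field k] [NumberField k] (ρ : k →+* ℂ) (P : PeriodRealization k), HodgeRiemannIStatement P.B → HodgeRiemannIIStatement P.B → P.B.W.HasHardLefschetz → ∀ ⦃n : ℕ⦄ ⦃X : SchemeOver k⦄, IsSmoothProjective n X → ∀ (hXρ : IsSmoothProjective n ((baseChangeHom ρ).obj X)) (p : ℕ), Submodule.span ℚ {x : P.B.W.obj ((baseChangeHom ρ).obj X) (2 * p) | ∃ (m : ℕ) (Y : SchemeOver ℂ) (_ : IsSmoothProjective m Y) (η : P.B.W.obj (((baseChangeHom ρ).obj X) ⊗ Y) 2) (_ : P.B.W.IsHyperplaneClass (((baseChangeHom ρ).obj X) ⊗ Y) η) (S : P.B.W.GradedOp (((baseChangeHom ρ).obj X) ⊗ Y) (((baseChangeHom ρ).obj X) ⊗ Y)) (_ : P.B.W.IsLefschetzStar (n + m) η S) (a b b' : ℕ) (_ : b + b' = n + m) (hab : a + b' = p + m) (α : P.B.W.obj (((baseChangeHom ρ).obj X) ⊗ Y) (2 * a)) (γ : P.B.W.obj (((baseChangeHom ρ).obj X) ⊗ Y) (2 * b)), α ∈ P.B.W.ratAlgebraicClasses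 (((baseChangeHom ρ).obj X) ⊗ Y) a ∧ γ ∈ P.B.W.ratAlgebraicClasses (((baseChangeHom ρ).obj X) ⊗ Y) b ∧ ∀ (q : ℕ) (hq : p + q = n) (y : P.B.W.obj ((baseChangeHom ρ).obj X) (2 * q)), P.B.W.cupPairing ((baseChangeHom ρ).obj X) n (2 * p) (2 * q) (by omega) x y = P.B.W.trace (((baseChangeHom ρ).obj X) ⊗ Y) (n + m) (P.B.W.cup (show 2 * (p + m) + 2 * q = 2 * (n + m) by omega) (P.B.W.cup (show 2 * a + 2 * b' = 2 * (p + m) by omega) α (S (2 * b) (2 * b') γ)) (P.B.W.pullback (fst ((baseChangeHom ρ).obj X) Y) (2 * q) y))} ≤ P.B.W.algebraicClasses ((baseChangeHom ρ).obj X) p) →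
    Summit.HodgeConjecture.HodgeConjecture.Theses.AdelicCoherence.CoherentClassesAlgebraic :=
  CoherentClassesAlgebraic_of

/-- The crux from the two stubs (what provers closing both pieces land). -/
theorem coherentClassesAlgebraic : Summit.HodgeConjecture.HodgeConjecture.Theses.AdelicCoherence.CoherentClassesAlgebraic :=
  CoherentClassesAlgebraic_of stub_coherentClassesMotivated stub_motivatedClassesAlgebraic

/-! ### §4 Sanity -/

/-- The inlined André set is `WeilCohomology.IsMotivatedClass` of the tree, definitionally, so the ℚ-span in the pieces IS
`WeilCohomology.motivatedClasses n X_ρ p`. -/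
theorem inlinedSpan_eq_motivatedClasses {k : Type} [Field k] [NumberField k] (ρ : k →+* ℂ) (P : PeriodRealization k) (n : ℕ)
    (X : SchemeOver k) (p : ℕ) :
    Submodule.span ℚ {x : P.B.W.obj ((baseChangeHom ρ).obj X) (2 * p) | ∃ (m : ℕ) (Y : SchemeOver ℂ) (_ : IsSmoothProjective m Y) (η : P.B.W.obj (((baseChangeHom ρ).obj X) ⊗ Y) 2) (_ : P.B.W.IsHyperplaneClass (((baseChangeHom ρ).obj X) ⊗ Y) η) (S : P.B.W.GradedOp (((baseChangeHom ρ).obj X) ⊗ Y) (((baseChangeHom ρ).obj X) ⊗ Y)) (_ : P.B.W.IsLefschetzStar (n + m) η S) (a b b' : ℕ) (_ : b + b' = n + m) (hab : a + b' = p + m) (α : P.B.W.obj (((baseChangeHom ρ).obj X) ⊗ Y) (2 * a)) (γ : P.B.W.obj (((baseChangeHom ρ).obj X) ⊗ Y) (2 * b)), α ∈ P.B.W.ratAlgebraicClasses (((baseChangeHom ρ).obj X) ⊗ Y) a ∧ γ ∈ P.B.W.ratAlgebraicClasses (((baseChangeHom ρ).obj X) ⊗ Y) b ∧ ∀ (q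 : ℕ) (hq : p + q = n) (y : P.B.W.obj ((baseChangeHom ρ).obj X) (2 * q)), P.B.W.cupPairing ((baseChangeHom ρ).obj X) n (2 * p) (2 * q) (by omega) x y = P.B.W.trace (((baseChangeHom ρ).obj X) ⊗ Y) (n + m) (P.B.W.cup (show 2 * (p + m) + 2 * q = 2 * (n + m) by omega) (P.B.W.cup (show 2 * a + 2 * b' = 2 * (p + m) by omega) α (S (2 * b) (2 * b') γ)) (P.B.W.pullback (fst ((baseChangeHom ρ).obj X) Y) (2 * q) y))} = P.B.W.motivatedClasses n ((baseChangeHom ρ).obj X) p := rfl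

/-- `B(P.B.W) ⇒ MA`: the second piece is implied by the standard conjecture of Lefschetz type for the Betti theory through
André's theorem `B ⇒ A_mot = A` (tree: `WeilCohomology.motivatedClasses_le_algebraicClasses`). [Andre1996Motifs §2.1] -/
theorem motivatedClassesAlgebraic_of_lefschetzB
    (hB : ∀ ⦃k : Type⦄ [Field k] [NumberField k] (P : PeriodRealization k), P.B.W.LefschetzStandardConjecture) :
    Statement.stub_motivatedClassesAlgebraic := by
  intro k _ _ ρ P hI hII hL n X hX hXρ p
  rw [inlinedSpan_eq_motivatedClasses]
  exact WeilCohomology.motivatedClasses_le_algebraicClasses (hB P) hXρ p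

/-- `C ⇒ CM` (the first piece is a CONSEQUENCE of the crux, as it must be for an honest cut: algebraic classes are motivated
under the hard-Lefschetz pin, tree `WeilCohomology.algebraicClasses_le_motivatedClasses_holds`). -/
theorem coherentClassesMotivated_of_crux (hC : Summit.HodgeConjecture.HodgeConjecture.Theses.AdelicCoherence.CoherentClassesAlgebraic) :
    Statement.stub_coherentClassesMotivated := by
  intro k _ _ ρ P hI hII hL n X hX hXρ p W hW hT β hβ hspan
  rw [inlinedSpan_eq_motivatedClasses]
  exact WeilCohomology.algebraicClasses_le_motivatedClasses_holds (W := P.B.W) hL hXρ p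
    (hC ρ P hI hII hL hX hXρ p W hW hT β hβ hspan)

end Summit.HodgeConjecture.HodgeConjecture.Cruxes.CoherentClassesAlgebraic.PiecesSplit
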